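import Mathlib.CategoryTheory.Core
import Literature.IUT.HodgeTheaters.FrobeniusEtalePictures
import Literature.IUT.LogThetaLattice.LatticeGlue
import Literature.IUT.LogThetaLattice.RadialDataCore
import HarnessLib

/-!
# [IUTchIII] Corollary 2.3 (ii): the étale-picture of radial data at the level of the IDENTIFICATIONS —
# chain-generated poly-isomorphisms of coric data (proof companion of `RadialData.lean` / `RadialDataCore.lean`)

Mochizuki, *Inter-universal Teichmüller Theory III*, kurims manuscript (May 2020), §2, Corollary 2.3 (ii), p. 74
[cite: Mochizuki2012, III Cor 2.3 (ii) p.74]; [IUTchII] Corollary 4.11 (i)(ii) p.164 [cite: Mochizuki2012, II Cor 4.11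
p.164] (D-0012 claim key, status DISPUTED). Companion (abc-iut cell, layer L6, DISCHARGE-L6 §F row F8, sub-DAG
`plan/L6/SUBDAG-IUTchIII-Cor-23.md` rows r3–r6; SUPPLEMENT to abc-iut-w4-d026's census file
`EtalePictureThetaProofs.lean`, which it does not import and whose theorems it does not restate): elementary category
theory over the INTERFACE `ThetaCoricData` (`RadialData.lean`) and the glue `LatticeGlue`; nothing here asserts a
disputed claim or takes a side on [IUTchIII] Cor 3.12.

Printed text (p.74): "… the horizontal arrows of the Gaussian log-theta-lattice under consideration induce full
poly-isomorphisms `… ⥲ ^{n,m}D^⊢_△ ⥲ ^{n+1,m}D^⊢_△ ⥲ …` of `D^⊢`-prime-strips [cf. Theorem 1.5, (ii)]. Write `^{◦,◦}ℭ` for the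
collection of coric data obtained by identifying the various `^{n,◦}ℭ`, for `n ∈ ℤ`, via these poly-isomorphisms.
Thus … we obtain a diagram — i.e., an étale-picture of radial data — as in Fig. 2.4 … This diagram satisfies the
important property of admitting arbitrary permutation symmetries among the spokes [i.e., the labels `n ∈ ℤ`] and
is compatible, in the evident sense, with the étale-picture of `D-Θ^{±ell}NF`-Hodge theaters of [IUTchII], Corollary
4.11, (ii)."

What is PROVED.
* GENERIC (supplement to abc-iut-L5-t2's `chainPolyIso` / `chainPolyIso_eq_full` of
  `HodgeTheaters/FrobeniusEtalePictures.lean`, declared next to them by absolute name): `chainPolyIso_map_full` — if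
  every edge of a `ℤ`-chain is the image under a functor `G` ("functorial algorithm") of the FULL poly-isomorphism
  between consecutive, mutually isomorphic objects, then the poly-isomorphism GENERATED by the chain between ANY two
  vertices is the image under `G` of the full poly-isomorphism (`G = 𝟭` is `chainPolyIso_eq_full`).
* The identifications "via these poly-isomorphisms" = `ThetaCoricData.coricPolyIso`, the image of the FULL
  poly-isomorphism of `D^⊢`-prime-strips under `†D^⊢ ↦ (†D^⊢, F^{⊢×μ}(†D^⊢))` (`Coric.coreFunctor` of `RadialDataCore`);
  `RadialData`'s `horizontalCoricPolyIso` IS this set (`horizontalCoricPolyIso_eq`, row r6 / Thm 1.5 (ii)); the radial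
  algorithm carries the vertical (spoke) poly-isomorphism of radial data [Thm 1.5 (i), row r5] INTO it
  (`image_radialAlgorithm_verticalRadialPolyIso_subset`).
* Fig. 2.4, one horizontal line: the poly-isomorphisms GENERATED along the chain of horizontal arrows are EXACTLY the
  `D^⊢_△`-induced identifications (`etalePictureCoric_eq`) — the hub `F^{⊢×μ}_△(^{◦,◦}D^⊢_△)` is route-independent; hence
  "arbitrary permutation symmetries among the spokes" at the level of the identifications (`etalePictureCoric_relabel`,
  the [IUTchI] Cor 3.9-style reading `EtalePermutationSymmetric` of abc-iut-L5-t2; the graph-level sentence is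
  abc-iut-L6-t3's `etalePicture.spokePerm`).
* "compatible, in the evident sense, with … [IUTchII], Corollary 4.11, (ii)" (row r3): forgetting `F^{⊢×μ}(−)` projects
  the identifications ONTO the full poly-isomorphisms `ⁿD^⊢_△ ⥲ ⁿ'D^⊢_△` of [IUTchII] Cor 4.11 (i)
  (`image_d_coricPolyIso`, `image_d_etalePictureCoric`; spokes: `image_ξ_verticalRadialPolyIso`), and the
  `F^{⊢×μ}`-components are the `D^⊢`-induced ("bi-coric", Thm 1.5 (iii)) poly-isomorphism — on `BiCores`' copies through
  the glue, `BiCoricData.horizontalPolyIso` (`image_δ_coricPolyIso`, `LatticeGlue.image_δ_coricPolyIso_eq_horizontalPolyIso`).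

Deliberately NOT here: Cor 2.3 (i), (iii), (iv) (abc-iut-w4-d026's `EtalePictureThetaProofs.lean`; (iii) at the
`F^{⊢×μ}`-level over the glue: `EtalePictureKummerProofs.lean`). Non-vacuity: `LatticeGlue`/`ThetaCoricData` are
inhabited (`StripFrameWitness.twoGlue`, `twoCoric`, abc-iut-L6-t3). Typed ≠ endorsed.
-/

/-! ### A generic lemma: chains whose edges are functorial images of full poly-isomorphisms -/

namespace Literature.IUT.HodgeTheaters

open CategoryTheory

universe v₁ u₁ v₂ u₂

section ChainMap

variable {𝒟 : Type u₁} [Category.{v₁} 𝒟] {𝒞 : Type u₂} [Category.{v₂} 𝒞] (G : 𝒟 ⥤ 𝒞) (Y : ℤ → 𝒟)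

/-- **IUTchI:§0** (kurims p.33) / **IUTchIII:Cor2.3(ii)** (kurims p.74) Membership in a poly-isomorphism GENERATED by
a chain whose `n`-th edge is the image under a functor `G` ("functorial algorithm") of the full poly-isomorphism
`Y n ⥲ Y (n+1)`: every generated isomorphism is a `G`-image. [claim: Mochizuki2012, status: disputed] -/
theorem ChainGen.exists_mapIso_eq {a b : ℤ} {f : G.obj (Y a) ≅ G.obj (Y b)}
    (hf : ChainGen (fun n => G.obj (Y n)) (fun n => (PolyIso.full (Y n) (Y (n + 1))).map G) a b f) :
    ∃ i : Y a ≅ Y b, G.mapIso i = f := by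
  refine ChainGen.rec (motive := fun a b f _ => ∃ i : Y a ≅ Y b, G.mapIso i = f)
    (ofEdge := fun hg => ?_) (refl := fun a => ⟨Iso.refl _, G.mapIso_refl _⟩) (symm := fun _ ih => ?_)
    (trans := fun _ _ ih₁ ih₂ => ?_) hf
  · obtain ⟨i, -, hi⟩ := PolyIso.mem_map.mp hg
    exact ⟨i, hi⟩
  · obtain ⟨i, rfl⟩ := ih
    exact ⟨i.symm, G.mapIso_symm i⟩
  · obtain ⟨i, rfl⟩ := ih₁
    obtain ⟨j, rfl⟩ := ih₂
    exact ⟨i ≪≫ j, G.mapIso_trans i j⟩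

/-- **IUTchI:§0** (kurims p.33) / **IUTchIII:Cor2.3(ii)** (kurims p.74) Conversely, when consecutive objects of the
chain are isomorphic, EVERY `G`-image `G(i)`, `i : Y a ⥲ Y b`, is generated by the chain (route `i` through the
chain; an automorphism `i` of `Y a` is `(i ≫ j) ≫ j⁻¹` for any `j : Y a ⥲ Y (a+1)`). [claim: Mochizuki2012, status: disputed] -/
theorem ChainGen.mapIso (hne : ∀ n, Nonempty (Y n ≅ Y (n + 1))) (a b : ℤ) (i : Y a ≅ Y b) :
    ChainGen (fun n => G.obj (Y n)) (fun n => (PolyIso.full (Y n) (Y (n + 1))).map G) a b (G.mapIso i) := by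
  have edge : ∀ (n : ℤ) (j : Y n ≅ Y (n + 1)),
      ChainGen (fun n => G.obj (Y n)) (fun n => (PolyIso.full (Y n) (Y (n + 1))).map G) n (n + 1) (G.mapIso j) :=
    fun n j => ChainGen.ofEdge (PolyIso.mem_map.mpr ⟨j, PolyIso.mem_full _, rfl⟩)
  -- automorphisms of `Y a`
  have aut : ∀ (a : ℤ) (i : Y a ≅ Y a),
      ChainGen (fun n => G.obj (Y n)) (fun n => (PolyIso.full (Y n) (Y (n + 1))).map G) a a (G.mapIso i) := by
    intro a i
    obtain ⟨j⟩ := hne a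
    have h := ChainGen.trans (edge a (i ≪≫ j)) (ChainGen.symm (edge a j))
    rwa [G.mapIso_trans, Iso.trans_assoc, Iso.self_symm_id, Iso.trans_refl] at h
  -- forward along the chain
  have fwd : ∀ (a b : ℤ), a ≤ b → ∀ i : Y a ≅ Y b,
      ChainGen (fun n => G.obj (Y n)) (fun n => (PolyIso.full (Y n) (Y (n + 1))).map G) a b (G.mapIso i) := by
    intro a b hab
    induction b, hab using Int.leInduction with
    | base => exact aut a
    | succ n hmn ih =>
      intro i
      obtain ⟨j⟩ := hne n
      have h := ChainGen.trans (ih (i ≪≫ j.symm)) (edge n j)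
      rwa [← G.mapIso_trans, Iso.trans_assoc, Iso.symm_self_id, Iso.trans_refl] at h
  rcases le_total a b with hab | hba
  · exact fwd a b hab i
  · have h := ChainGen.symm (fwd b a hba i.symm)
    rwa [G.mapIso_symm, Iso.symm_symm_eq] at h

/-- **IUTchI:§0** (kurims p.33) / **IUTchIII:Cor2.3(ii)** (kurims p.74) **Chains of functorial images of full
poly-isomorphisms.** If the `n`-th edge of a `ℤ`-indexed chain is the image under a functor `G` of the FULL
poly-isomorphism `Y n ⥲ Y (n+1)` and consecutive objects are isomorphic, then the poly-isomorphism generated by the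
chain between ANY two vertices `a`, `b` is the image under `G` of the full poly-isomorphism `Y a ⥲ Y b` — in
particular it depends only on the two vertices, not on the chain (generalises abc-iut-L5-t2's
`chainPolyIso_eq_full`, the case `G = 𝟭`). [claim: Mochizuki2012, status: disputed] -/
theorem chainPolyIso_map_full (hne : ∀ n, Nonempty (Y n ≅ Y (n + 1))) (a b : ℤ) :
    chainPolyIso (fun n => G.obj (Y n)) (fun n => (PolyIso.full (Y n) (Y (n + 1))).map G) a b =
      (PolyIso.full (Y a) (Y b)).map G := by
  ext f
  simp only [chainPolyIso, Set.mem_setOf_eq, PolyIso.mem_map, PolyIso.mem_full, true_and]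
  exact ⟨ChainGen.exists_mapIso_eq G Y, by rintro ⟨i, rfl⟩; exact ChainGen.mapIso G Y hne a b i⟩

end ChainMap

end Literature.IUT.HodgeTheaters

namespace Literature.IUT.LogThetaLattice

open CategoryTheory
open Literature.IUT.HodgeTheaters

universe u

variable {S : StripFrame.{u}}

/-! ### Cor 2.3 (ii): the identifications of coric data induced by isomorphisms of `D^⊢`-prime-strips -/

namespace ThetaCoricData

variable (E : ThetaCoricData S)

/-- **IUTchIII:Cor2.3(ii)** (kurims p.74) The isomorphism of coric data `(†D^⊢, F^{⊢×μ}(†D^⊢)) ⥲ (‡D^⊢, F^{⊢×μ}(‡D^⊢))`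
INDUCED by an isomorphism `d : †D^⊢ ⥲ ‡D^⊢` of `D^⊢`-prime-strips through the functorial algorithm
`†D^⊢ ↦ F^{⊢×μ}(†D^⊢)` [IUTchII, Cor 4.5 (ii)] — `Coric.coreFunctor` of `RadialDataCore.lean` on `Core.isoMk d`.
[claim: Mochizuki2012, status: disputed] -/
def isoOfDv {X Y : S.Dv} (d : X ≅ Y) : (⟨X⟩ : Coric E) ≅ ⟨Y⟩ :=
  (Coric.coreFunctor E).mapIso (Core.isoMk (x := ⟨X⟩) (y := ⟨Y⟩) d)

/-- **IUTchIII:Cor2.3(ii)** (kurims p.74) the underlying morphism of coric data of `isoOfDv d` is `(d, F^{⊢×μ}(d))`.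
[claim: Mochizuki2012, status: disputed] -/
@[simp] theorem isoOfDv_hom {X Y : S.Dv} (d : X ≅ Y) :
    (E.isoOfDv d).hom = ⟨d, E.fxmOfDv.mapIso d, E.mapIso_fxmOfDv_dv d⟩ := rfl

/-- **IUTchIII:Cor2.3(ii)** (kurims p.74) its (a_{Morℭ})-component is `d`. [claim: Mochizuki2012, status: disputed] -/
@[simp] theorem isoOfDv_hom_d {X Y : S.Dv} (d : X ≅ Y) : (E.isoOfDv d).hom.d = d := rfl

/-- **IUTchIII:Cor2.3(ii)** (kurims p.74) its (b_{Morℭ})-component is `F^{⊢×μ}(d)`. [claim: Mochizuki2012, status: disputed] -/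
@[simp] theorem isoOfDv_hom_δ {X Y : S.Dv} (d : X ≅ Y) : (E.isoOfDv d).hom.δ = E.fxmOfDv.mapIso d := rfl

/-- **IUTchIII:Cor2.3(ii)** (kurims p.74) "Write `^{◦,◦}ℭ` for the collection of coric data obtained by identifying
the various `^{n,◦}ℭ` … via these poly-isomorphisms" — the IDENTIFICATIONS between two coric data `(†D^⊢, F^{⊢×μ}(†D^⊢))`,
`(‡D^⊢, F^{⊢×μ}(‡D^⊢))`: the image of the FULL poly-isomorphism `†D^⊢ ⥲ ‡D^⊢` of `D^⊢`-prime-strips [Thm 1.5 (ii);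
IUTchII Cor 4.10 (iv), 4.11 (i)] under `†D^⊢ ↦ (†D^⊢, F^{⊢×μ}(†D^⊢))`. [claim: Mochizuki2012, status: disputed] -/
def coricPolyIso (X Y : S.Dv) : PolyIso (⟨X⟩ : Coric E) ⟨Y⟩ :=
  (PolyIso.full (⟨X⟩ : Core S.Dv) ⟨Y⟩).map (Coric.coreFunctor E)

/-- **IUTchIII:Cor2.3(ii)** (kurims p.74) membership: the identifications are exactly the `isoOfDv d`,
`d : †D^⊢ ⥲ ‡D^⊢`. [claim: Mochizuki2012, status: disputed] -/
theorem mem_coricPolyIso {X Y : S.Dv} {i : (⟨X⟩ : Coric E) ≅ ⟨Y⟩} :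
    i ∈ E.coricPolyIso X Y ↔ ∃ d : X ≅ Y, E.isoOfDv d = i := by
  constructor
  · rintro ⟨f, -, rfl⟩
    have hf : Core.isoMk (x := ⟨X⟩) (y := ⟨Y⟩) f.hom.iso = f := Iso.ext rfl
    exact ⟨f.hom.iso, congrArg (Coric.coreFunctor E).mapIso hf⟩
  · rintro ⟨d, rfl⟩
    exact ⟨Core.isoMk d, PolyIso.mem_full _, rfl⟩

/-- **IUTchIII:Cor2.3(ii)** (kurims p.74) `isoOfDv d` is one of the identifications. [claim: Mochizuki2012, status: disputed] -/
theorem isoOfDv_mem_coricPolyIso {X Y : S.Dv} (d : X ≅ Y) : E.isoOfDv d ∈ E.coricPolyIso X Y :=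
  E.mem_coricPolyIso.mpr ⟨d, rfl⟩

/-- **IUTchIII:Cor2.3(ii)** (kurims p.74) the identifications are nonempty (any two `D^⊢`-prime-strips are
isomorphic, `ThetaCoricData.iso_nonempty_Dv`). [claim: Mochizuki2012, status: disputed] -/
theorem coricPolyIso_nonempty (X Y : S.Dv) : (E.coricPolyIso X Y).Nonempty :=
  ⟨_, E.isoOfDv_mem_coricPolyIso (E.iso_nonempty_Dv X Y).some⟩

/-- **IUTchIII:Cor2.3(ii)** (kurims p.74) ↦ **[IUTchII] Cor 4.11 (i)/(ii)** (kurims p.164) "compatible, in the evident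
sense, with the étale-picture of `D-Θ^{±ell}NF`-Hodge theaters of [IUTchII], Corollary 4.11, (ii)" — on the hub:
FORGETTING `F^{⊢×μ}(−)` (passing to (a_{Morℭ})) maps the identifications of coric data ONTO the FULL poly-isomorphism
`†D^⊢_△ ⥲ ‡D^⊢_△` by which [IUTchII] Cor 4.11 (i) identifies the mono-analytic cores "`(−)D^⊢_△`" (sub-DAG row Cor-23.ii.r3).
[claim: Mochizuki2012, status: disputed] -/
theorem image_d_coricPolyIso (X Y : S.Dv) :
    (fun i : (⟨X⟩ : Coric E) ≅ ⟨Y⟩ => i.hom.d) '' E.coricPolyIso X Y = PolyIso.full X Y := by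
  ext d
  simp only [Set.mem_image, PolyIso.mem_full, iff_true]
  exact ⟨E.isoOfDv d, E.isoOfDv_mem_coricPolyIso d, rfl⟩

/-- **IUTchIII:Cor2.3(ii)** (kurims p.74) ↦ **Thm 1.5 (ii)/(iii)** (kurims pp.48–49): on the `F^{⊢×μ}`-prime-strips
(passing to (b_{Morℭ})) the identifications of coric data are exactly the `D^⊢`-INDUCED poly-isomorphism
`F^{⊢×μ}(†D^⊢) ⥲ F^{⊢×μ}(‡D^⊢)` — the image of the full poly-isomorphism of `D^⊢`-prime-strips under `F^{⊢×μ}(−)`, i.e. the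
"bi-coric" poly-isomorphism of Thm 1.5 (iii) in `RadialData`'s copy (`BiCoricData.horizontalPolyIso` is the `BiCores`
copy; cf. `LatticeGlue.image_δ_coricPolyIso_eq_horizontalPolyIso`) (sub-DAG row Cor-23.ii.r6).
[claim: Mochizuki2012, status: disputed] -/
theorem image_δ_coricPolyIso (X Y : S.Dv) :
    (fun i : (⟨X⟩ : Coric E) ≅ ⟨Y⟩ => i.hom.δ) '' E.coricPolyIso X Y = (PolyIso.full X Y).map E.fxmOfDv := by
  ext e
  simp only [Set.mem_image, PolyIso.mem_map, PolyIso.mem_full, true_and]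
  constructor
  · rintro ⟨i, hi, rfl⟩
    obtain ⟨d, rfl⟩ := E.mem_coricPolyIso.mp hi
    exact ⟨d, rfl⟩
  · rintro ⟨d, rfl⟩
    exact ⟨E.isoOfDv d, E.isoOfDv_mem_coricPolyIso d, rfl⟩

end ThetaCoricData

/-! ### Cor 2.3 (ii): the radial algorithm on the vertical poly-isomorphisms; the horizontal identifications -/

section Lattice

variable (E : ThetaCoricData S)

/-- **IUTchIII:Cor2.3(ii)** (kurims p.74) ↦ **Thm 1.5 (i)** (kurims p.48) The radial algorithm `Φ` on the morphism of
radial data induced (`Radial.Hom.ofDHT`) by an isomorphism `ξ` of `D`-Hodge theaters is the coric identification induced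
by the `D^⊢`-isomorphism `D^⊢_△(ξ)` (`RadialDataCore`'s `Radial.inducedDv_ofDHT`). [claim: Mochizuki2012, status: disputed] -/
theorem radialAlgorithm_map_ofDHT {R R' : Radial E} (ξ : R.ht ≅ R'.ht) :
    (radialAlgorithm E).map (Radial.Hom.ofDHT ξ) = (E.isoOfDv (E.dvDelta.mapIso ξ)).hom :=
  Coric.hom_ext ((radialAlgorithm_map_d E _).trans (Radial.inducedDv_ofDHT E ξ)) rfl

/-- **IUTchIII:Cor2.3(ii)** (kurims p.74) ↦ **Thm 1.5 (i)** / **[IUTchII] Cor 4.11 (ii)**: forgetting to `D`-Hodge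
theaters ((a_{Morℜ})), the vertical poly-isomorphism of radial data projects ONTO the full poly-isomorphism
`^{n,m}HT^D ⥲ ^{n,m+1}HT^D` of Thm 1.5 (i) — the spoke `^{n,◦}HT^D` of the `D`-étale-picture of [IUTchII] Cor 4.11 (ii)
under the spoke `^{n,◦}ℜ` of Fig. 2.4 (sub-DAG rows Cor-23.ii.r3/r5). [claim: Mochizuki2012, status: disputed] -/
theorem image_ξ_verticalRadialPolyIso (H : ℤ × ℤ → S.DHT) (n m : ℤ) :
    (fun f : latticeRadial E H (n, m) ⟶ latticeRadial E H (n, m + 1) => (f.ξ : H (n, m) ≅ H (n, m + 1))) ''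
        verticalRadialPolyIso E H n m = PolyIso.full (H (n, m)) (H (n, m + 1)) := by
  ext ξ
  constructor
  · intro _
    exact PolyIso.mem_full ξ
  · intro _
    exact ⟨Radial.Hom.ofDHT ξ, ⟨ξ, rfl⟩, rfl⟩

/-- **IUTchIII:Cor2.3(ii)** (kurims p.74) ↦ **Thm 1.5 (ii)** (kurims p.48) "the horizontal arrows … induce full
poly-isomorphisms `… ⥲ ^{n,m}D^⊢_△ ⥲ ^{n+1,m}D^⊢_△ ⥲ …` of `D^⊢`-prime-strips [cf. Theorem 1.5, (ii)]. Write `^{◦,◦}ℭ` for the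
collection of coric data obtained by identifying the various `^{n,◦}ℭ` … via these poly-isomorphisms": `RadialData`'s
`horizontalCoricPolyIso` (the morphisms of coric data induced by ALL `D^⊢`-isomorphisms `^{n,m}D^⊢_△ ⥲ ^{n+1,m}D^⊢_△`) is
the set of underlying morphisms of `coricPolyIso` (sub-DAG row Cor-23.ii.r6). [claim: Mochizuki2012, status: disputed] -/
theorem horizontalCoricPolyIso_eq (H : ℤ × ℤ → S.DHT) (n m : ℤ) :
    horizontalCoricPolyIso E H n m =
      Iso.hom '' E.coricPolyIso (E.dvDelta.obj (H (n, m))) (E.dvDelta.obj (H (n + 1, m))) := by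
  ext f
  constructor
  · rintro ⟨d, rfl⟩
    exact ⟨E.isoOfDv d, E.isoOfDv_mem_coricPolyIso d, rfl⟩
  · rintro ⟨i, hi, rfl⟩
    obtain ⟨d, rfl⟩ := E.mem_coricPolyIso.mp hi
    exact ⟨d, rfl⟩

/-- **IUTchIII:Cor2.3(ii)** (kurims p.74) ↦ **Thm 1.5 (i)** (kurims p.48) the vertical poly-isomorphism of radial data
is carried by the radial algorithm to the coric identifications induced by the `D^⊢`-isomorphisms `D^⊢_△(ξ)`,
`ξ : ^{n,m}HT^D ⥲ ^{n,m+1}HT^D` (so the spokes `^{n,◦}ℜ` of Fig. 2.4 are well-defined on coric data and attached to the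
hub by identifications of hub type). [claim: Mochizuki2012, status: disputed] -/
theorem image_radialAlgorithm_verticalRadialPolyIso (H : ℤ × ℤ → S.DHT) (n m : ℤ) :
    (radialAlgorithm E).map '' verticalRadialPolyIso E H n m =
      Set.range fun ξ : H (n, m) ≅ H (n, m + 1) => (E.isoOfDv (E.dvDelta.mapIso ξ)).hom := by
  ext f
  constructor
  · rintro ⟨_, ⟨ξ, rfl⟩, rfl⟩
    exact ⟨ξ, (radialAlgorithm_map_ofDHT E ξ).symm⟩
  · rintro ⟨ξ, rfl⟩
    exact ⟨_, ⟨ξ, rfl⟩, radialAlgorithm_map_ofDHT E ξ⟩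

/-- **IUTchIII:Cor2.3(ii)** (kurims p.74) hence the radial algorithm carries the vertical (spoke) poly-isomorphism INTO
the coric identifications of hub type `coricPolyIso` between `^{n,m}D^⊢_△` and `^{n,m+1}D^⊢_△`. [claim: Mochizuki2012, status: disputed] -/
theorem image_radialAlgorithm_verticalRadialPolyIso_subset (H : ℤ × ℤ → S.DHT) (n m : ℤ) :
    (radialAlgorithm E).map '' verticalRadialPolyIso E H n m ⊆
      Iso.hom '' E.coricPolyIso (E.dvDelta.obj (H (n, m))) (E.dvDelta.obj (H (n, m + 1))) := by
  rw [image_radialAlgorithm_verticalRadialPolyIso]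
  rintro _ ⟨ξ, rfl⟩
  exact ⟨_, E.isoOfDv_mem_coricPolyIso _, rfl⟩

/-! ### Cor 2.3 (ii): the étale-picture of radial data (Fig. 2.4) — the poly-isomorphisms generated along a horizontal line -/

/-- **IUTchIII:Cor2.3(ii)** (kurims p.74) **Fig. 2.4, one horizontal line `m`**: the poly-isomorphisms between the coric
data `Φ(^{a,m}ℜ)`, `Φ(^{b,m}ℜ)` GENERATED (composites and inverses, abc-iut-L5-t2's `chainPolyIso`) by the identifications
"via these poly-isomorphisms" along the chain of horizontal arrows `… → (n,m) → (n+1,m) → …`.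
[claim: Mochizuki2012, status: disputed] -/
def etalePictureCoric (H : ℤ × ℤ → S.DHT) (m : ℤ) (a b : ℤ) :
    PolyIso (⟨E.dvDelta.obj (H (a, m))⟩ : Coric E) ⟨E.dvDelta.obj (H (b, m))⟩ :=
  chainPolyIso (fun n => (⟨E.dvDelta.obj (H (n, m))⟩ : Coric E))
    (fun n => E.coricPolyIso (E.dvDelta.obj (H (n, m))) (E.dvDelta.obj (H (n + 1, m)))) a b

/-- **IUTchIII:Cor2.3(ii)** (kurims p.74) **the hub `F^{⊢×μ}_△(^{◦,◦}D^⊢_△)` is well defined**: the poly-isomorphism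
generated along the horizontal line between the coric data at `(a, m)` and `(b, m)` is EXACTLY the set of coric
identifications `coricPolyIso` induced by the full poly-isomorphism `^{a,m}D^⊢_△ ⥲ ^{b,m}D^⊢_△` — independent of the route
through the chain (`chainPolyIso_map_full` for the functorial algorithm `†D^⊢ ↦ (†D^⊢, F^{⊢×μ}(†D^⊢))`).
[claim: Mochizuki2012, status: disputed] -/
theorem etalePictureCoric_eq (H : ℤ × ℤ → S.DHT) (m a b : ℤ) :
    etalePictureCoric E H m a b = E.coricPolyIso (E.dvDelta.obj (H (a, m))) (E.dvDelta.obj (H (b, m))) :=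
  chainPolyIso_map_full (Coric.coreFunctor E) (fun n => (⟨E.dvDelta.obj (H (n, m))⟩ : Core S.Dv))
    (fun _ => ⟨Core.isoMk (E.iso_nonempty_Dv _ _).some⟩) a b

/-- **IUTchIII:Cor2.3(ii)** (kurims p.74) "This diagram satisfies the important property of admitting **arbitrary
permutation symmetries among the spokes** [i.e., the labels `n ∈ ℤ`]" — at the level of the identifications (the
graph-level sentence is abc-iut-L6-t3's `etalePicture.spokePerm`): relabelling the spokes of the line `m` by any
permutation `σ` of `ℤ` yields the SAME generated poly-isomorphisms between the same coric data (contrast: the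
Frobenius-picture admits translations only, `frobeniusPicture.aut_eq_translate`). [claim: Mochizuki2012, status: disputed] -/
theorem etalePictureCoric_relabel (H : ℤ × ℤ → S.DHT) (σ : Equiv.Perm ℤ) (m a b : ℤ) :
    etalePictureCoric E (fun p => H (σ p.1, p.2)) m a b = etalePictureCoric E H m (σ a) (σ b) := by
  rw [etalePictureCoric_eq, etalePictureCoric_eq]

/-- **IUTchIII:Cor2.3(ii)** (kurims p.74) ↦ **[IUTchII] Cor 4.11 (i)** (kurims p.164): forgetting `F^{⊢×μ}(−)`, the
poly-isomorphism generated along a line of the étale-picture of radial data projects ONTO the full poly-isomorphism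
`^{a,m}D^⊢_△ ⥲ ^{b,m}D^⊢_△` of the chain "`… ⥲ ⁿD^⊢_△ ⥲ ⁽ⁿ⁺¹⁾D^⊢_△ ⥲ …`" of [IUTchII] Cor 4.11 (i) (its mono-analytic core
"`(−)D^⊢_△`") — "compatible, in the evident sense, with the étale-picture … of [IUTchII], Corollary 4.11, (ii)"
(sub-DAG row Cor-23.ii.r3). [claim: Mochizuki2012, status: disputed] -/
theorem image_d_etalePictureCoric (H : ℤ × ℤ → S.DHT) (m a b : ℤ) :
    (fun i => i.hom.d) '' etalePictureCoric E H m a b =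
      PolyIso.full (E.dvDelta.obj (H (a, m))) (E.dvDelta.obj (H (b, m))) := by
  rw [etalePictureCoric_eq]
  exact E.image_d_coricPolyIso _ _

end Lattice

/-! ### Cor 2.3 (ii) over the glue: the `F^{⊢×μ}`-components are `BiCores`' bi-coric poly-isomorphism -/

namespace LatticeGlue

variable (G : LatticeGlue S)

/-- **IUTchIII:Cor2.3(ii)** (kurims p.74) ↦ **Thm 1.5 (iii)** (kurims p.49) through the glue: transported along
`fxmOfDv_iso` (`RadialData`'s `F^{⊢×μ}(−)` is `BiCores`'), the `F^{⊢×μ}`-components of the coric identifications are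
EXACTLY the `D^⊢`-induced ("bi-coric") poly-isomorphism of `BiCores.lean` (`BiCoricData.horizontalPolyIso H H'` when
`X = ^{H}D^⊢_△`, `Y = ^{H'}D^⊢_△`) (sub-DAG row Cor-23.ii.r6). [claim: Mochizuki2012, status: disputed] -/
theorem image_δ_coricPolyIso_eq_map (X Y : S.Dv) :
    (fun i : (⟨X⟩ : Coric G.coric) ≅ ⟨Y⟩ => (G.fxmOfDv_iso.app X).symm ≪≫ i.hom.δ ≪≫ G.fxmOfDv_iso.app Y) ''
        G.coric.coricPolyIso X Y = (PolyIso.full X Y).map G.biCoric.fxmOfDv := by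
  have nat : ∀ d : X ≅ Y,
      (G.fxmOfDv_iso.app X).symm ≪≫ G.coric.fxmOfDv.mapIso d ≪≫ G.fxmOfDv_iso.app Y = G.biCoric.fxmOfDv.mapIso d := by
    intro d
    ext
    simp only [Iso.trans_hom, Iso.symm_hom, Functor.mapIso_hom, Iso.app_hom, Iso.app_inv]
    exact NatIso.naturality_1 G.fxmOfDv_iso d.hom
  ext e
  simp only [Set.mem_image, PolyIso.mem_map, PolyIso.mem_full, true_and]
  constructor
  · rintro ⟨i, hi, rfl⟩
    obtain ⟨d, rfl⟩ := G.coric.mem_coricPolyIso.mp hi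
    exact ⟨d, (nat d).symm⟩
  · rintro ⟨d, rfl⟩
    exact ⟨G.coric.isoOfDv d, G.coric.isoOfDv_mem_coricPolyIso d, nat d⟩

/-- **IUTchIII:Cor2.3(ii)** (kurims p.74) ↦ **Thm 1.5 (iii)** (kurims p.49) in particular at the `D^⊢_△` of two `D`-Hodge
theaters: the glue-transported `F^{⊢×μ}`-components of the coric identifications form `BiCoricData.horizontalPolyIso`
(on `BiCores`' copies of `D^⊢_△`). [claim: Mochizuki2012, status: disputed] -/
theorem image_δ_coricPolyIso_eq_horizontalPolyIso (H H' : S.DHT) :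
    (fun i : (⟨G.biCoric.dvDeltaOf H⟩ : Coric G.coric) ≅ ⟨G.biCoric.dvDeltaOf H'⟩ =>
        (G.fxmOfDv_iso.app _).symm ≪≫ i.hom.δ ≪≫ G.fxmOfDv_iso.app _) ''
      G.coric.coricPolyIso (G.biCoric.dvDeltaOf H) (G.biCoric.dvDeltaOf H') = G.biCoric.horizontalPolyIso H H' :=
  G.image_δ_coricPolyIso_eq_map _ _

end LatticeGlue

end Literature.IUT.LogThetaLattice
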